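import Literature.NumberTheory.Sieve.DrappeauDispersionSkeleton
import Literature.NumberTheory.Sieve.DrappeauDispersionMainTerms
import Literature.NumberTheory.Sieve.MontgomeryVaughan1975GaussSums
import Mathlib.NumberTheory.ArithmeticFunction.Defs
import Mathlib.NumberTheory.DirichletCharacter.Bounds
import HarnessLib

/-!
# Drappeau 2017, §5.3.1: `𝒮₃` against its main term `α̂(0) X₃` — the algebraic part, proved

S. Drappeau, *Sums of Kloosterman sums in arithmetic progressions, and the error term in the
dispersion method*, Proc. London Math. Soc. (3) 114 (2017) 684–732 = arXiv:1504.05549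
(`Drappeau2017`; held as `paper:arxiv-1504.05549`, §5.3.1 read on chunk 18).

§5.3.1 of the source evaluates the dispersion sum `𝒮₃` of the proof of **Theorem 5.1**
(`Literature.NumberTheory.Sieve.Drappeau2017_theorem51`; `𝒮₃ = Drappeau2017.dispS3` of
`…DrappeauDispersionSkeleton`):
"By multiplicativity, (5.14) `𝒮₃ = ∑_{(q₁q₂,a₁a₂)=1} γ(q₁)γ(q₂)/(φ(q₁)φ(q₂)) ∑_{χ₁ ∈ 𝒳_{q₁}(R), χ₂ ∈ 𝒳_{q₂}(R)}
∑_{n₁,n₂} β_{n₁}β̄_{n₂} ∑_{(m,q₁q₂)=1} α(m) χ₁(mn₁ā₁a₂) χ̄₂(mn₂ā₁a₂)`.  Let `W := [q₁,q₂]` …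
By Poisson summation `∑_m α(m)χ₁χ̄₂(m) = (α̂(0)/W) ∑_{b mod W, (b,W)=1} χ₁χ̄₂(b) + [error]` …
We deduce `𝒮₃ = α̂(0) X₃ + O(MN²x^{-1/2})` where … `X₃ := ∑ γ(q₁)γ(q₂)/([q₁,q₂]φ(q₁)φ(q₂))
∑_{χ₁,χ₂} ∑_{n₁,n₂} β_{n₁}β̄_{n₂} ∑_{b mod W, (b,W)=1} χ₁(bn₁)χ̄₂(bn₂)`.  By orthogonality … (5.15) …
Since `φ([q₁,q₂]) = φ(q₁)φ(q₂)/φ((q₁,q₂))`, we deduce (5.16)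
`X₃ = ∑ γ(q₁)γ(q₂)/([q₁,q₂]φ((q₁,q₂))) ∑_{χ₀ ∈ 𝒳_{(q₁,q₂)}(R)} ∑_{n₁,n₂} β_{n₁}β̄_{n₂} χ₀(n₁n̄₂)`."

This file PROVES everything in this paragraph except the Poisson summation step (the analytic
input), in the following form (`𝒳_q(R) = {χ mod q : cond χ ≤ R}`, `nⱼ' = nⱼ ā₁ a₂ mod qⱼ`,
`χ̄(t) = χ(t)⁻¹` for the values of Dirichlet characters, `conj_apply_eq_inv`):

* `dispS3_eq_sum_chars` — **(5.14)**: `𝒮₃ = ∑_{q₁,q₂} γ(q₁)γ(q₂) (φ(q₁)φ(q₂))⁻¹ ∑_{χ₁,χ₂} ∑_{n₁,n₂}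
  β_{n₁}β̄_{n₂} χ₁(n₁')χ̄₂(n₂') ∑_m w(m) χ₁(m)χ̄₂(m)` (for the weight `w` on the finite `m`-range of
  `dispS3`; no coprimality condition on `m` is needed, the characters vanish off the units);
* `mul_mainX3_eq_sum_chars` — **(5.15)–(5.16) read backwards**: for any `A` (`= α̂(0)`),
  `A · X₃ = ∑_{q₁,q₂} γ(q₁)γ(q₂) (φ(q₁)φ(q₂))⁻¹ ∑_{χ₁,χ₂} ∑_{n₁,n₂} β_{n₁}β̄_{n₂} χ₁(n₁')χ̄₂(n₂')
  · (A/W) ∑_{b mod W, (b,W)=1} χ₁(b)χ̄₂(b)`, `W = [q₁,q₂]` (`X₃ = Drappeau2017.mainX3` is (5.16); the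
  proof is the source's: orthogonality `∑_b χ₁χ̄₂(b) = φ(W) 1_{χ₁∼χ₂}`, (5.15), and
  `φ(W)φ((q₁,q₂)) = φ(q₁)φ(q₂)`, `totient_lcm_mul_totient_gcd`);
* `dispS3_sub_mul_mainX3_eq` — hence `𝒮₃ − A X₃ = ∑ … χ₁(n₁')χ̄₂(n₂') · E(χ₁,χ₂)` with
  `E(χ₁,χ₂) = ∑_m w(m)χ₁χ̄₂(m) − (A/W) ∑_{b mod W,(b,W)=1} χ₁χ̄₂(b)`, and the resulting bound
  `norm_dispS3_sub_mul_mainX3_le`: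
  `|𝒮₃ − A X₃| ≤ ∑_{q₁,q₂} |γ(q₁)γ(q₂)| (φ(q₁)φ(q₂))⁻¹ #𝒳_{q₁}(R) #𝒳_{q₂}(R) (∑_n |β_n|)² · E`
  whenever `|E(χ₁,χ₂)| ≤ E` throughout (the Poisson/Gauss-sum estimate of the source supplies
  `E = O_ε(W^ε R^{1/2})`; it is not proved here).

## References

* S. Drappeau, Proc. London Math. Soc. (3) 114 (2017) 684–732, arXiv:1504.05549, §5.3.1
  (5.14)–(5.16). [Drappeau2017]
-/

noncomputable section

open Finset DirichletCharacter

namespace Literature.NumberTheory.Sieve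

namespace Drappeau2017

/-! ### Generic rearrangements -/

/-- `∑_a ∑_b ∑_i ∑_j = ∑_i ∑_j ∑_a ∑_b`. [folklore] -/
theorem sum_sum_sum_sum_comm {α β ι κ M : Type*} [AddCommMonoid M] (A : Finset α) (B : Finset β)
    (s : Finset ι) (t : Finset κ) (f : α → β → ι → κ → M) :
    ∑ a ∈ A, ∑ b ∈ B, ∑ i ∈ s, ∑ j ∈ t, f a b i j =
      ∑ i ∈ s, ∑ j ∈ t, ∑ a ∈ A, ∑ b ∈ B, f a b i j := by
  have h1 : ∀ a ∈ A, ∑ b ∈ B, ∑ i ∈ s, ∑ j ∈ t, f a b i j =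
      ∑ i ∈ s, ∑ j ∈ t, ∑ b ∈ B, f a b i j := by
    intro a _
    rw [Finset.sum_comm (s := B) (t := s)]
    exact Finset.sum_congr rfl fun i _ => Finset.sum_comm
  rw [Finset.sum_congr rfl h1, Finset.sum_comm (s := A) (t := s)]
  exact Finset.sum_congr rfl fun i _ => Finset.sum_comm

/-- `∑_a ∑_b c(a,b) · K ∑_i ∑_j F = K ∑_i ∑_j ∑_a ∑_b c(a,b) F`. [folklore] -/
theorem sum_sum_mul_mul_sum_sum {α β ι κ : Type*} (A : Finset α) (B : Finset β) (s : Finset ι)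
    (t : Finset κ) (c : α → β → ℂ) (K : ℂ) (F : ι → κ → α → β → ℂ) :
    ∑ a ∈ A, ∑ b ∈ B, c a b * (K * ∑ i ∈ s, ∑ j ∈ t, F i j a b) =
      K * ∑ i ∈ s, ∑ j ∈ t, ∑ a ∈ A, ∑ b ∈ B, c a b * F i j a b := by
  rw [Finset.mul_sum]
  simp only [Finset.mul_sum]
  rw [sum_sum_sum_sum_comm A B s t]
  refine Finset.sum_congr rfl fun i _ => Finset.sum_congr rfl fun j _ =>
    Finset.sum_congr rfl fun a _ => Finset.sum_congr rfl fun b _ => ?_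
  ring

/-! ### `φ([q₁,q₂]) φ((q₁,q₂)) = φ(q₁) φ(q₂)` -/

/-- `φ([a,b]) φ((a,b)) = φ(a) φ(b)` (multiplicativity of `φ`). [folklore] -/
theorem totient_lcm_mul_totient_gcd (a b : ℕ) :
    Nat.totient (Nat.lcm a b) * Nat.totient (Nat.gcd a b) = Nat.totient a * Nat.totient b := by
  let f : ArithmeticFunction ℕ := ⟨Nat.totient, Nat.totient_zero⟩
  have hf : f.IsMultiplicative := ⟨Nat.totient_one, fun h => Nat.totient_mul h⟩
  exact hf.lcm_apply_mul_gcd_apply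

/-! ### The kernels as character sums over `𝒳_q(R)` -/

/-- `K_R(t; q) = φ(q)⁻¹ ∑_{χ ∈ 𝒳_q(R)} χ(t)`. [cite: Drappeau2017, §5 (5.1)] -/
theorem mainKernel_eq_inv_mul_sum_filter (R : ℝ) (q : ℕ) (t : ZMod q) :
    mainKernel R q t = ((Nat.totient q : ℂ))⁻¹ *
      ∑ χ ∈ (univ.filter fun χ : DirichletCharacter ℂ q => (χ.conductor : ℝ) ≤ R), χ t := by
  unfold mainKernel
  rw [Finset.sum_filter]

/-- `K̄_R(t; q) = φ(q)⁻¹ ∑_{χ ∈ 𝒳_q(R)} χ̄(t)`, `χ̄(t) = χ(t)⁻¹`. [cite: Drappeau2017, §5 (5.1)] -/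
theorem conj_mainKernel_eq_inv_mul_sum_filter (R : ℝ) (q : ℕ) (t : ZMod q) :
    starRingEnd ℂ (mainKernel R q t) = ((Nat.totient q : ℂ))⁻¹ *
      ∑ χ ∈ (univ.filter fun χ : DirichletCharacter ℂ q => (χ.conductor : ℝ) ≤ R), (χ t)⁻¹ := by
  rw [mainKernel_eq_inv_mul_sum_filter, map_mul, map_inv₀, map_natCast, map_sum]
  exact congrArg _ (Finset.sum_congr rfl fun χ _ => conj_apply_eq_inv χ t)

/-- The kernel argument splits: `m n ā₁ a₂ = m · (n ā₁ a₂)`. [cite: Drappeau2017, §5.3 (5.14)] -/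
theorem kerArg_eq_mul (a₁ a₂ : ℤ) (q m n : ℕ) :
    kerArg a₁ a₂ q m n = (m : ZMod q) * ((n : ZMod q) * ((a₁ : ZMod q))⁻¹ * (a₂ : ZMod q)) := by
  unfold kerArg
  push_cast
  ring

/-! ### (5.14): the `m`-sum of `𝒮₃` by multiplicativity -/

/-- The `m`-sum of `𝒮₃` expanded over `𝒳_{q₁}(R) × 𝒳_{q₂}(R)` ("by multiplicativity", (5.14)):
`∑_m w(m) K_R(mn₁ā₁a₂; q₁) K̄_R(mn₂ā₁a₂; q₂)
  = (φ(q₁)φ(q₂))⁻¹ ∑_{χ₁,χ₂} χ₁(n₁ā₁a₂) χ̄₂(n₂ā₁a₂) ∑_m w(m) χ₁(m) χ̄₂(m)`.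
[cite: Drappeau2017, §5.3.1 (5.14)] -/
theorem sum_mul_mainKernel_mul_conj_eq (R : ℝ) (a₁ a₂ : ℤ) (q₁ q₂ : ℕ) (ℳ : Finset ℕ)
    (w : ℕ → ℝ) (n₁ n₂ : ℕ) :
    ∑ m ∈ ℳ, (w m : ℂ) * mainKernel R q₁ (kerArg a₁ a₂ q₁ m n₁) *
        starRingEnd ℂ (mainKernel R q₂ (kerArg a₁ a₂ q₂ m n₂)) =
      (((Nat.totient q₁ : ℂ)) * (Nat.totient q₂ : ℂ))⁻¹ *
        ∑ χ₁ ∈ (univ.filter fun χ : DirichletCharacter ℂ q₁ => (χ.conductor : ℝ) ≤ R),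
          ∑ χ₂ ∈ (univ.filter fun χ : DirichletCharacter ℂ q₂ => (χ.conductor : ℝ) ≤ R),
            χ₁ ((n₁ : ZMod q₁) * ((a₁ : ZMod q₁))⁻¹ * (a₂ : ZMod q₁)) *
              (χ₂ ((n₂ : ZMod q₂) * ((a₁ : ZMod q₂))⁻¹ * (a₂ : ZMod q₂)))⁻¹ *
              ∑ m ∈ ℳ, (w m : ℂ) * (χ₁ (m : ZMod q₁) * (χ₂ (m : ZMod q₂))⁻¹) := by
  set 𝒳₁ := (univ.filter fun χ : DirichletCharacter ℂ q₁ => (χ.conductor : ℝ) ≤ R) with h𝒳₁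
  set 𝒳₂ := (univ.filter fun χ : DirichletCharacter ℂ q₂ => (χ.conductor : ℝ) ≤ R) with h𝒳₂
  set N₁ : ZMod q₁ := (n₁ : ZMod q₁) * ((a₁ : ZMod q₁))⁻¹ * (a₂ : ZMod q₁) with hN₁
  set N₂ : ZMod q₂ := (n₂ : ZMod q₂) * ((a₁ : ZMod q₂))⁻¹ * (a₂ : ZMod q₂) with hN₂
  -- expand the kernels and use multiplicativity
  have hker : ∀ m : ℕ, (w m : ℂ) * mainKernel R q₁ (kerArg a₁ a₂ q₁ m n₁) *
      starRingEnd ℂ (mainKernel R q₂ (kerArg a₁ a₂ q₂ m n₂)) =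
      (((Nat.totient q₁ : ℂ)) * (Nat.totient q₂ : ℂ))⁻¹ *
        ((w m : ℂ) * (∑ χ₁ ∈ 𝒳₁, χ₁ (m : ZMod q₁) * χ₁ N₁) *
          (∑ χ₂ ∈ 𝒳₂, (χ₂ (m : ZMod q₂))⁻¹ * (χ₂ N₂)⁻¹)) := by
    intro m
    rw [mainKernel_eq_inv_mul_sum_filter, conj_mainKernel_eq_inv_mul_sum_filter, kerArg_eq_mul,
      kerArg_eq_mul]
    have e₁ : ∑ χ ∈ 𝒳₁, χ ((m : ZMod q₁) * N₁) = ∑ χ₁ ∈ 𝒳₁, χ₁ (m : ZMod q₁) * χ₁ N₁ :=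
      Finset.sum_congr rfl fun χ _ => by rw [map_mul]
    have e₂ : ∑ χ ∈ 𝒳₂, (χ ((m : ZMod q₂) * N₂))⁻¹ =
        ∑ χ₂ ∈ 𝒳₂, (χ₂ (m : ZMod q₂))⁻¹ * (χ₂ N₂)⁻¹ :=
      Finset.sum_congr rfl fun χ _ => by rw [map_mul, mul_inv]
    rw [e₁, e₂, mul_inv]
    ring
  rw [Finset.sum_congr rfl fun m _ => hker m, ← Finset.mul_sum]
  congr 1
  -- `∑_m w (∑_{χ₁} f₁) (∑_{χ₂} f₂) = ∑_{χ₁} ∑_{χ₂} ∑_m w f₁ f₂`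
  have hprod : ∀ m : ℕ, (w m : ℂ) * (∑ χ₁ ∈ 𝒳₁, χ₁ (m : ZMod q₁) * χ₁ N₁) *
      (∑ χ₂ ∈ 𝒳₂, (χ₂ (m : ZMod q₂))⁻¹ * (χ₂ N₂)⁻¹) =
      ∑ χ₁ ∈ 𝒳₁, ∑ χ₂ ∈ 𝒳₂, χ₁ N₁ * (χ₂ N₂)⁻¹ *
        ((w m : ℂ) * (χ₁ (m : ZMod q₁) * (χ₂ (m : ZMod q₂))⁻¹)) := by
    intro m
    rw [mul_assoc, Finset.sum_mul_sum, Finset.mul_sum]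
    refine Finset.sum_congr rfl fun χ₁ _ => ?_
    rw [Finset.mul_sum]
    refine Finset.sum_congr rfl fun χ₂ _ => ?_
    ring
  rw [Finset.sum_congr rfl fun m _ => hprod m, Finset.sum_comm]
  refine Finset.sum_congr rfl fun χ₁ _ => ?_
  rw [Finset.sum_comm]
  refine Finset.sum_congr rfl fun χ₂ _ => ?_
  rw [Finset.mul_sum]

/-- **(5.14)**: `𝒮₃` expanded over the characters,
`𝒮₃ = ∑_{q₁,q₂} γ(q₁)γ(q₂) (φ(q₁)φ(q₂))⁻¹ ∑_{χ₁ ∈ 𝒳_{q₁}(R)} ∑_{χ₂ ∈ 𝒳_{q₂}(R)} ∑_{n₁,n₂}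
  β_{n₁} β̄_{n₂} χ₁(n₁ā₁a₂) χ̄₂(n₂ā₁a₂) ∑_m w(m) χ₁(m) χ̄₂(m)`. [cite: Drappeau2017, §5.3.1 (5.14)] -/
theorem dispS3_eq_sum_chars (R : ℝ) (a₁ a₂ : ℤ) (𝒬 ℳ 𝒩 : Finset ℕ) (γ w : ℕ → ℝ) (β : ℕ → ℂ) :
    dispS3 R a₁ a₂ 𝒬 ℳ 𝒩 γ w β =
      ∑ q₁ ∈ 𝒬.filter (fun q : ℕ => IsCoprime (q : ℤ) (a₁ * a₂)),
        ∑ q₂ ∈ 𝒬.filter (fun q : ℕ => IsCoprime (q : ℤ) (a₁ * a₂)), (γ q₁ : ℂ) * (γ q₂ : ℂ) *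
          ((((Nat.totient q₁ : ℂ)) * (Nat.totient q₂ : ℂ))⁻¹ *
            ∑ χ₁ ∈ (univ.filter fun χ : DirichletCharacter ℂ q₁ => (χ.conductor : ℝ) ≤ R),
              ∑ χ₂ ∈ (univ.filter fun χ : DirichletCharacter ℂ q₂ => (χ.conductor : ℝ) ≤ R),
                ∑ n₁ ∈ 𝒩.filter (fun n : ℕ => IsCoprime (n : ℤ) a₂),
                  ∑ n₂ ∈ 𝒩.filter (fun n : ℕ => IsCoprime (n : ℤ) a₂),
                    β n₁ * starRingEnd ℂ (β n₂) *
                      (χ₁ ((n₁ : ZMod q₁) * ((a₁ : ZMod q₁))⁻¹ * (a₂ : ZMod q₁)) *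
                        (χ₂ ((n₂ : ZMod q₂) * ((a₁ : ZMod q₂))⁻¹ * (a₂ : ZMod q₂)))⁻¹) *
                      ∑ m ∈ ℳ, (w m : ℂ) * (χ₁ (m : ZMod q₁) * (χ₂ (m : ZMod q₂))⁻¹)) := by
  unfold dispS3
  refine Finset.sum_congr rfl fun q₁ _ => Finset.sum_congr rfl fun q₂ _ => ?_
  congr 1
  simp only [sum_mul_mainKernel_mul_conj_eq]
  rw [sum_sum_mul_mul_sum_sum]
  refine congrArg _ (Finset.sum_congr rfl fun χ₁ _ => Finset.sum_congr rfl fun χ₂ _ =>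
    Finset.sum_congr rfl fun n₁ _ => Finset.sum_congr rfl fun n₂ _ => ?_)
  ring

/-! ### (5.15)–(5.16): the `b`-sums against the twisted character values -/

/-- An integer inverse of `a₁` modulo `q₁q₂`, from `(qⱼ, a₁a₂) = 1`. [folklore] -/
theorem exists_int_inv_of_isCoprime {q₁ q₂ : ℕ} {a₁ a₂ : ℤ} (ha₁ : IsCoprime (q₁ : ℤ) (a₁ * a₂))
    (ha₂ : IsCoprime (q₂ : ℤ) (a₁ * a₂)) : ∃ u : ℤ, ((q₁ : ℤ) * q₂) ∣ a₁ * u - 1 := by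
  have h : IsCoprime a₁ ((q₁ : ℤ) * q₂) :=
    IsCoprime.mul_right ha₁.of_mul_right_left.symm ha₂.of_mul_right_left.symm
  obtain ⟨u, v, huv⟩ := h
  exact ⟨u, ⟨-v, by linear_combination huv⟩⟩

/-- If `d ∣ a u − 1` then `ā = u` in `ZMod d`. [folklore] -/
theorem inv_intCast_eq_of_dvd {d : ℕ} {a u : ℤ} (h : (d : ℤ) ∣ a * u - 1) :
    ((a : ZMod d))⁻¹ = (u : ZMod d) := by
  apply ZMod.inv_eq_of_mul_eq_one
  have h0 : ((a * u - 1 : ℤ) : ZMod d) = 0 := (ZMod.intCast_zmod_eq_zero_iff_dvd _ _).2 h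
  push_cast at h0
  linear_combination h0

/-- If `d ∣ a u − 1` then `u` is coprime to `d`. [folklore] -/
theorem isCoprime_of_dvd_mul_sub_one {d : ℕ} {a u : ℤ} (h : (d : ℤ) ∣ a * u - 1) :
    IsCoprime u d := by
  obtain ⟨k, hk⟩ := h
  exact ⟨a, -k, by linear_combination hk⟩

/-- With `u` an inverse of `a₁` modulo `q₁q₂` and `d ∣ q₁q₂`: `n ā₁ a₂ = n u a₂` in `ZMod d`, an
integer representative of the twist. [folklore] -/
theorem twist_eq_intCast {q₁ q₂ d : ℕ} {a₁ u : ℤ} (hu : ((q₁ : ℤ) * q₂) ∣ a₁ * u - 1)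
    (hd : d ∣ q₁ * q₂) (a₂ : ℤ) (n : ℕ) :
    (n : ZMod d) * ((a₁ : ZMod d))⁻¹ * (a₂ : ZMod d) = ((n * u * a₂ : ℤ) : ZMod d) := by
  have hdZ : (d : ℤ) ∣ (q₁ : ℤ) * q₂ := by exact_mod_cast hd
  rw [inv_intCast_eq_of_dvd (hdZ.trans hu)]
  push_cast
  ring

/-- `|χ(t)⁻¹| ≤ 1` for the values of a Dirichlet character. [folklore] -/
theorem norm_inv_apply_le_one {q : ℕ} (χ : DirichletCharacter ℂ q) (t : ZMod q) :
    ‖(χ t)⁻¹‖ ≤ 1 := by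
  by_cases ht : IsUnit t
  · obtain ⟨v, rfl⟩ := ht
    rw [norm_inv, χ.unit_norm_eq_one v, inv_one]
  · rw [MulChar.map_nonunit χ ht, inv_zero, norm_zero]
    exact zero_le_one

/-- **(5.15) for the twisted values, summed against the `b`-sums**: for `q₁, q₂ ∣ W`,
`(qⱼ, a₁a₂) = 1`, weights `c(n₁,n₂)` and `nⱼ' = nⱼ ā₁ a₂ mod qⱼ`,
`∑_{χ₁ ∈ 𝒳_{q₁}(R)} ∑_{χ₂ ∈ 𝒳_{q₂}(R)} ∑_{n₁,n₂} c(n₁,n₂) χ₁(n₁') χ̄₂(n₂') ∑_{b mod W,(b,W)=1} χ₁(b)χ̄₂(b)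
  = φ(W) ∑_{χ₀ ∈ 𝒳_{(q₁,q₂)}(R)} ∑_{n₁: (n₁,q₁)=1} ∑_{n₂: (n₂,q₂)=1} c(n₁,n₂) χ₀(n₁ n̄₂)`
("By orthogonality `∑_b χ₁χ̄₂(b) = φ(W) 1_{χ₁∼χ₂}` … Therefore
`∑_{χ₁,χ₂} χ₁(n₁)χ̄₂(n₂) 1_{χ₁∼χ₂} = ∑_{χ₀ ∈ 𝒳_{(q₁,q₂)}(R)} χ₀(n₁n̄₂)`"; the factors `ā₁a₂` cancel,
and the terms with `(nⱼ, qⱼ) > 1` vanish). [cite: Drappeau2017, §5.3.1 (5.15)] -/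
theorem sum_sum_twist_mul_sum_units_eq {q₁ q₂ W : ℕ} [NeZero W] (h₁ : q₁ ∣ W) (h₂ : q₂ ∣ W)
    (R : ℝ) {a₁ a₂ : ℤ} (ha₁ : IsCoprime (q₁ : ℤ) (a₁ * a₂)) (ha₂ : IsCoprime (q₂ : ℤ) (a₁ * a₂))
    (𝒩' : Finset ℕ) (c : ℕ → ℕ → ℂ) :
    ∑ χ₁ ∈ (univ.filter fun χ : DirichletCharacter ℂ q₁ => (χ.conductor : ℝ) ≤ R),
      ∑ χ₂ ∈ (univ.filter fun χ : DirichletCharacter ℂ q₂ => (χ.conductor : ℝ) ≤ R),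
        ∑ n₁ ∈ 𝒩', ∑ n₂ ∈ 𝒩',
          c n₁ n₂ * (χ₁ ((n₁ : ZMod q₁) * ((a₁ : ZMod q₁))⁻¹ * (a₂ : ZMod q₁)) *
            (χ₂ ((n₂ : ZMod q₂) * ((a₁ : ZMod q₂))⁻¹ * (a₂ : ZMod q₂)))⁻¹) *
            ∑ b : (ZMod W)ˣ, χ₁ ((b : ZMod W).cast : ZMod q₁) *
              (χ₂ ((b : ZMod W).cast : ZMod q₂))⁻¹ =
      (Nat.totient W : ℂ) *
        ∑ χ₀ ∈ (univ.filter fun χ : DirichletCharacter ℂ (Nat.gcd q₁ q₂) =>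
            (χ.conductor : ℝ) ≤ R),
          ∑ n₁ ∈ 𝒩'.filter (fun n => n.Coprime q₁), ∑ n₂ ∈ 𝒩'.filter (fun n => n.Coprime q₂),
            c n₁ n₂ * χ₀ ((n₁ : ZMod (Nat.gcd q₁ q₂)) * ((n₂ : ZMod (Nat.gcd q₁ q₂)))⁻¹) := by
  classical
  haveI hq₁ : NeZero q₁ := ⟨fun h => NeZero.ne W (Nat.eq_zero_of_zero_dvd (h ▸ h₁))⟩
  haveI hq₂ : NeZero q₂ := ⟨fun h => NeZero.ne W (Nat.eq_zero_of_zero_dvd (h ▸ h₂))⟩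
  set g := Nat.gcd q₁ q₂ with hg
  set 𝒳₁ := (univ.filter fun χ : DirichletCharacter ℂ q₁ => (χ.conductor : ℝ) ≤ R) with h𝒳₁
  set 𝒳₂ := (univ.filter fun χ : DirichletCharacter ℂ q₂ => (χ.conductor : ℝ) ≤ R) with h𝒳₂
  set 𝒳₀ := (univ.filter fun χ : DirichletCharacter ℂ g => (χ.conductor : ℝ) ≤ R) with h𝒳₀
  -- an integer inverse `u` of `a₁` modulo `q₁ q₂`
  obtain ⟨u, hu⟩ := exists_int_inv_of_isCoprime ha₁ ha₂
  simp only [twist_eq_intCast hu (dvd_mul_right q₁ q₂), twist_eq_intCast hu (dvd_mul_left q₂ q₁)]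
  -- coprimality facts
  have huq₁ : IsCoprime u q₁ :=
    isCoprime_of_dvd_mul_sub_one ((Int.dvd_mul_right (q₁ : ℤ) q₂).trans hu)
  have huq₂ : IsCoprime u q₂ :=
    isCoprime_of_dvd_mul_sub_one ((Int.dvd_mul_left (q₁ : ℤ) q₂).trans hu)
  have ha₂q₁ : IsCoprime a₂ q₁ := ha₁.of_mul_right_right.symm
  have ha₂q₂ : IsCoprime a₂ q₂ := ha₂.of_mul_right_right.symm
  -- combine the twists with the `b`-sums
  have hcomb : ∀ (χ₁ : DirichletCharacter ℂ q₁) (χ₂ : DirichletCharacter ℂ q₂) (n₁ n₂ : ℕ),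
      χ₁ ((n₁ * u * a₂ : ℤ) : ZMod q₁) * (χ₂ ((n₂ * u * a₂ : ℤ) : ZMod q₂))⁻¹ *
          ∑ b : (ZMod W)ˣ, χ₁ ((b : ZMod W).cast : ZMod q₁) *
            (χ₂ ((b : ZMod W).cast : ZMod q₂))⁻¹ =
        ∑ b : (ZMod W)ˣ, χ₁ (((b : ZMod W).cast : ZMod q₁) * ((n₁ * u * a₂ : ℤ) : ZMod q₁)) *
          (χ₂ (((b : ZMod W).cast : ZMod q₂) * ((n₂ * u * a₂ : ℤ) : ZMod q₂)))⁻¹ := by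
    intro χ₁ χ₂ n₁ n₂
    rw [Finset.mul_sum]
    refine Finset.sum_congr rfl fun b _ => ?_
    rw [map_mul, map_mul, mul_inv]
    ring
  have hL : ∑ χ₁ ∈ 𝒳₁, ∑ χ₂ ∈ 𝒳₂, ∑ n₁ ∈ 𝒩', ∑ n₂ ∈ 𝒩',
      c n₁ n₂ * (χ₁ ((n₁ * u * a₂ : ℤ) : ZMod q₁) * (χ₂ ((n₂ * u * a₂ : ℤ) : ZMod q₂))⁻¹) *
        ∑ b : (ZMod W)ˣ, χ₁ ((b : ZMod W).cast : ZMod q₁) *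
          (χ₂ ((b : ZMod W).cast : ZMod q₂))⁻¹ =
      ∑ n₁ ∈ 𝒩', ∑ n₂ ∈ 𝒩', c n₁ n₂ * ∑ χ₁ ∈ 𝒳₁, ∑ χ₂ ∈ 𝒳₂,
        ∑ b : (ZMod W)ˣ, χ₁ (((b : ZMod W).cast : ZMod q₁) * ((n₁ * u * a₂ : ℤ) : ZMod q₁)) *
          (χ₂ (((b : ZMod W).cast : ZMod q₂) * ((n₂ * u * a₂ : ℤ) : ZMod q₂)))⁻¹ := by
    rw [sum_sum_sum_sum_comm]
    refine Finset.sum_congr rfl fun n₁ _ => Finset.sum_congr rfl fun n₂ _ => ?_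
    rw [Finset.mul_sum]
    refine Finset.sum_congr rfl fun χ₁ _ => ?_
    rw [Finset.mul_sum]
    refine Finset.sum_congr rfl fun χ₂ _ => ?_
    rw [mul_assoc, hcomb]
  rw [hL]
  -- evaluate the character sums for each `(n₁, n₂)`
  have hval : ∀ n₁ n₂ : ℕ, ∑ χ₁ ∈ 𝒳₁, ∑ χ₂ ∈ 𝒳₂,
      ∑ b : (ZMod W)ˣ, χ₁ (((b : ZMod W).cast : ZMod q₁) * ((n₁ * u * a₂ : ℤ) : ZMod q₁)) *
        (χ₂ (((b : ZMod W).cast : ZMod q₂) * ((n₂ * u * a₂ : ℤ) : ZMod q₂)))⁻¹ =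
      if n₁.Coprime q₁ ∧ n₂.Coprime q₂ then
        (Nat.totient W : ℂ) * ∑ χ₀ ∈ 𝒳₀, χ₀ ((n₁ : ZMod g) * ((n₂ : ZMod g))⁻¹) else 0 := by
    intro n₁ n₂
    split_ifs with hcop
    · have hM₁ : IsCoprime (n₁ * u * a₂ : ℤ) q₁ :=
        ((Nat.isCoprime_iff_coprime.2 hcop.1).mul_left huq₁).mul_left ha₂q₁
      have hM₂ : IsCoprime (n₂ * u * a₂ : ℤ) q₂ :=
        ((Nat.isCoprime_iff_coprime.2 hcop.2).mul_left huq₂).mul_left ha₂q₂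
      rw [h𝒳₁, h𝒳₂, sum_sum_sum_units_eq h₁ h₂ R hM₁ hM₂]
      congr 1
      refine Finset.sum_congr rfl fun χ₀ _ => ?_
      -- the factors `u a₂` cancel
      have ht : IsUnit (((u * a₂ : ℤ)) : ZMod g) :=
        (ZMod.coe_int_isUnit_iff_isCoprime _ g).2
          ((huq₁.mul_left ha₂q₁).symm.of_isCoprime_of_dvd_left
            (Int.natCast_dvd_natCast.2 (Nat.gcd_dvd_left q₁ q₂)))
      have hχt : χ₀ (((u * a₂ : ℤ)) : ZMod g) ≠ 0 := fun h0 => by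
        have := ht.map χ₀
        rw [h0] at this
        exact not_isUnit_zero this
      have hn₂u : IsUnit (n₂ : ZMod g) :=
        (ZMod.isUnit_iff_coprime n₂ g).2 (hcop.2.coprime_dvd_right (Nat.gcd_dvd_right q₁ q₂))
      have e₁ : ((n₁ * u * a₂ : ℤ) : ZMod g) = (n₁ : ZMod g) * (((u * a₂ : ℤ)) : ZMod g) := by
        push_cast
        ring
      have e₂ : ((n₂ * u * a₂ : ℤ) : ZMod g) = (n₂ : ZMod g) * (((u * a₂ : ℤ)) : ZMod g) := by
        push_cast
        ring
      rw [e₁, e₂, map_mul, map_mul, mul_inv, map_mul, apply_inv_of_isUnit χ₀ hn₂u]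
      field_simp
    · -- a non-unit twist kills every term
      refine Finset.sum_eq_zero fun χ₁ _ => Finset.sum_eq_zero fun χ₂ _ =>
        Finset.sum_eq_zero fun b _ => ?_
      rcases not_and_or.1 hcop with hn | hn
      · rw [MulChar.map_nonunit χ₁ ?_, zero_mul]
        intro hunit
        apply hn
        have h' := (ZMod.coe_int_isUnit_iff_isCoprime _ q₁).1 (isUnit_of_mul_isUnit_right hunit)
        exact Nat.Coprime.symm (Nat.isCoprime_iff_coprime.1 h'.of_mul_right_left.of_mul_right_left)
      · rw [MulChar.map_nonunit χ₂ ?_, inv_zero, mul_zero]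
        intro hunit
        apply hn
        have h' := (ZMod.coe_int_isUnit_iff_isCoprime _ q₂).1 (isUnit_of_mul_isUnit_right hunit)
        exact Nat.Coprime.symm (Nat.isCoprime_iff_coprime.1 h'.of_mul_right_left.of_mul_right_left)
  simp only [hval]
  -- resum
  have hR : (Nat.totient W : ℂ) * ∑ χ₀ ∈ 𝒳₀, ∑ n₁ ∈ 𝒩'.filter (fun n => n.Coprime q₁),
      ∑ n₂ ∈ 𝒩'.filter (fun n => n.Coprime q₂),
        c n₁ n₂ * χ₀ ((n₁ : ZMod g) * ((n₂ : ZMod g))⁻¹) =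
      ∑ n₁ ∈ 𝒩'.filter (fun n => n.Coprime q₁), ∑ n₂ ∈ 𝒩'.filter (fun n => n.Coprime q₂),
        c n₁ n₂ * ((Nat.totient W : ℂ) * ∑ χ₀ ∈ 𝒳₀, χ₀ ((n₁ : ZMod g) * ((n₂ : ZMod g))⁻¹)) := by
    rw [Finset.sum_comm (s := 𝒳₀) (t := 𝒩'.filter (fun n => n.Coprime q₁)), Finset.mul_sum]
    refine Finset.sum_congr rfl fun n₁ _ => ?_
    rw [Finset.sum_comm (s := 𝒳₀) (t := 𝒩'.filter (fun n => n.Coprime q₂)), Finset.mul_sum]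
    refine Finset.sum_congr rfl fun n₂ _ => ?_
    rw [Finset.mul_sum, Finset.mul_sum, Finset.mul_sum]
    refine Finset.sum_congr rfl fun χ₀ _ => ?_
    ring
  rw [hR, Finset.sum_filter]
  refine Finset.sum_congr rfl fun n₁ _ => ?_
  split_ifs with hP₁
  · rw [Finset.sum_filter]
    refine Finset.sum_congr rfl fun n₂ _ => ?_
    by_cases hP₂ : n₂.Coprime q₂
    · rw [if_pos ⟨hP₁, hP₂⟩, if_pos hP₂]
    · rw [if_neg (fun h => hP₂ h.2), if_neg hP₂, mul_zero]
  · refine Finset.sum_eq_zero fun n₂ _ => ?_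
    rw [if_neg (fun h => hP₁ h.1), mul_zero]

/-- The complete sum of `j ↦ χ₁(j) χ̄₂(j)` over `0 ≤ j < [q₁,q₂]` is its sum over the units
`mod [q₁,q₂]` (the other terms vanish). [folklore] -/
theorem sum_range_lcm_twist_eq_sum_units {q₁ q₂ : ℕ} [NeZero (Nat.lcm q₁ q₂)]
    (χ₁ : DirichletCharacter ℂ q₁) (χ₂ : DirichletCharacter ℂ q₂) :
    ∑ j ∈ Finset.range (Nat.lcm q₁ q₂), χ₁ (j : ZMod q₁) * (χ₂ (j : ZMod q₂))⁻¹ =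
      ∑ b : (ZMod (Nat.lcm q₁ q₂))ˣ, χ₁ ((b : ZMod (Nat.lcm q₁ q₂)).cast : ZMod q₁) *
        (χ₂ ((b : ZMod (Nat.lcm q₁ q₂)).cast : ZMod q₂))⁻¹ := by
  have h₁ : q₁ ∣ Nat.lcm q₁ q₂ := Nat.dvd_lcm_left q₁ q₂
  have h₂ : q₂ ∣ Nat.lcm q₁ q₂ := Nat.dvd_lcm_right q₁ q₂
  rw [MontgomeryVaughan1975.sum_units_eq_sum
    (fun x : ZMod (Nat.lcm q₁ q₂) => χ₁ (x.cast : ZMod q₁) * (χ₂ (x.cast : ZMod q₂))⁻¹) ?_]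
  · rw [← MontgomeryVaughan1975.sum_range_eq_sum_zmod]
    refine Finset.sum_congr rfl fun j _ => ?_
    rw [ZMod.cast_natCast h₁, ZMod.cast_natCast h₂]
  · intro x hx
    have hxv : ((x.val : ℕ) : ZMod (Nat.lcm q₁ q₂)) = x := ZMod.natCast_zmod_val x
    have hncop : ¬ (x.val).Coprime (Nat.lcm q₁ q₂) := fun h =>
      hx (hxv ▸ (ZMod.isUnit_iff_coprime _ _).2 h)
    rw [← hxv, ZMod.cast_natCast h₁, ZMod.cast_natCast h₂]
    by_cases hc₁ : (x.val).Coprime q₁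
    · have hc₂ : ¬ (x.val).Coprime q₂ := fun hc₂ =>
        hncop ((Nat.Coprime.mul_right hc₁ hc₂).coprime_dvd_right (Nat.lcm_dvd_mul q₁ q₂))
      rw [MulChar.map_nonunit χ₂ (fun hu => hc₂ ((ZMod.isUnit_iff_coprime _ _).1 hu)), inv_zero,
        mul_zero]
    · rw [MulChar.map_nonunit χ₁ (fun hu => hc₁ ((ZMod.isUnit_iff_coprime _ _).1 hu)), zero_mul]

/-- **`A · X₃` over the characters** ((5.15)–(5.16) read backwards): for positive moduli and any
`A` (`= α̂(0)` in the source),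
`A X₃ = ∑_{q₁,q₂} γ(q₁)γ(q₂) (φ(q₁)φ(q₂))⁻¹ ∑_{χ₁,χ₂} ∑_{n₁,n₂} β_{n₁}β̄_{n₂} χ₁(n₁ā₁a₂) χ̄₂(n₂ā₁a₂)
        · (A/W) ∑_{b mod W} χ₁(b) χ̄₂(b)`, `W = [q₁,q₂]`
(the `b`-sum, written over `0 ≤ b < W`, lives on `(b,W)=1`; orthogonality, (5.15) and
`φ(W) φ((q₁,q₂)) = φ(q₁) φ(q₂)`).
[cite: Drappeau2017, §5.3.1 (5.15)–(5.16)] -/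
theorem mul_mainX3_eq_sum_chars (R : ℝ) (a₁ a₂ : ℤ) {𝒬 : Finset ℕ} (h𝒬 : ∀ q ∈ 𝒬, 0 < q)
    (𝒩 : Finset ℕ) (γ : ℕ → ℝ) (β : ℕ → ℂ) (A : ℂ) :
    A * mainX3 R a₁ a₂ 𝒬 𝒩 γ β =
      ∑ q₁ ∈ 𝒬.filter (fun q : ℕ => IsCoprime (q : ℤ) (a₁ * a₂)),
        ∑ q₂ ∈ 𝒬.filter (fun q : ℕ => IsCoprime (q : ℤ) (a₁ * a₂)), (γ q₁ : ℂ) * (γ q₂ : ℂ) *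
          ((((Nat.totient q₁ : ℂ)) * (Nat.totient q₂ : ℂ))⁻¹ *
            ∑ χ₁ ∈ (univ.filter fun χ : DirichletCharacter ℂ q₁ => (χ.conductor : ℝ) ≤ R),
              ∑ χ₂ ∈ (univ.filter fun χ : DirichletCharacter ℂ q₂ => (χ.conductor : ℝ) ≤ R),
                ∑ n₁ ∈ 𝒩.filter (fun n : ℕ => IsCoprime (n : ℤ) a₂),
                  ∑ n₂ ∈ 𝒩.filter (fun n : ℕ => IsCoprime (n : ℤ) a₂),
                    β n₁ * starRingEnd ℂ (β n₂) *
                      (χ₁ ((n₁ : ZMod q₁) * ((a₁ : ZMod q₁))⁻¹ * (a₂ : ZMod q₁)) *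
                        (χ₂ ((n₂ : ZMod q₂) * ((a₁ : ZMod q₂))⁻¹ * (a₂ : ZMod q₂)))⁻¹) *
                      (A / (Nat.lcm q₁ q₂ : ℂ) *
                        ∑ j ∈ Finset.range (Nat.lcm q₁ q₂),
                          χ₁ (j : ZMod q₁) * (χ₂ (j : ZMod q₂))⁻¹)) := by
  classical
  unfold mainX3
  rw [Finset.mul_sum]
  refine Finset.sum_congr rfl fun q₁ hq₁ => ?_
  rw [Finset.mul_sum]
  refine Finset.sum_congr rfl fun q₂ hq₂ => ?_
  obtain ⟨hq₁𝒬, hcop₁⟩ := Finset.mem_filter.1 hq₁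
  obtain ⟨hq₂𝒬, hcop₂⟩ := Finset.mem_filter.1 hq₂
  have hq₁0 : 0 < q₁ := h𝒬 q₁ hq₁𝒬
  have hq₂0 : 0 < q₂ := h𝒬 q₂ hq₂𝒬
  haveI : NeZero (Nat.lcm q₁ q₂) := ⟨Nat.lcm_ne_zero hq₁0.ne' hq₂0.ne'⟩
  -- pull `A/W` out and apply (5.15)
  have hpull : ∀ X Y S : ℂ, X * Y * (A / (Nat.lcm q₁ q₂ : ℂ) * S) =
      A / (Nat.lcm q₁ q₂ : ℂ) * (X * Y * S) := by
    intros
    ring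
  simp only [hpull]
  simp only [← Finset.mul_sum, sum_range_lcm_twist_eq_sum_units]
  rw [sum_sum_twist_mul_sum_units_eq (Nat.dvd_lcm_left q₁ q₂) (Nat.dvd_lcm_right q₁ q₂) R
    hcop₁ hcop₂]
  -- the weights: `A (γ₁γ₂/W) φ(g)⁻¹ = γ₁ γ₂ (φ₁φ₂)⁻¹ (A/W) φ(W)`
  have hφ : ((Nat.totient q₁ : ℂ)) * (Nat.totient q₂ : ℂ) =
      (Nat.totient (Nat.lcm q₁ q₂) : ℂ) * (Nat.totient (Nat.gcd q₁ q₂) : ℂ) := by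
    exact_mod_cast (totient_lcm_mul_totient_gcd q₁ q₂).symm
  have hφL : (Nat.totient (Nat.lcm q₁ q₂) : ℂ) ≠ 0 := by
    exact_mod_cast (Nat.totient_pos.2 (Nat.lcm_pos hq₁0 hq₂0)).ne'
  have hφg : (Nat.totient (Nat.gcd q₁ q₂) : ℂ) ≠ 0 := by
    exact_mod_cast (Nat.totient_pos.2 (Nat.gcd_pos_of_pos_left q₂ hq₁0)).ne'
  have hL : (Nat.lcm q₁ q₂ : ℂ) ≠ 0 := by exact_mod_cast (Nat.lcm_pos hq₁0 hq₂0).ne'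
  rw [hφ]
  push_cast
  field_simp

/-- **`𝒮₃ − A X₃` over the characters**: with `E(χ₁,χ₂) := ∑_m w(m)χ₁(m)χ̄₂(m) − (A/W) ∑_{b mod W,(b,W)=1}
χ₁(b)χ̄₂(b)` (`W = [q₁,q₂]`; the quantity the Poisson summation of §5.3.1 estimates),
`𝒮₃ − A X₃ = ∑_{q₁,q₂} γ(q₁)γ(q₂) (φ(q₁)φ(q₂))⁻¹ ∑_{χ₁,χ₂} ∑_{n₁,n₂} β_{n₁}β̄_{n₂}
  χ₁(n₁ā₁a₂) χ̄₂(n₂ā₁a₂) E(χ₁,χ₂)`. [cite: Drappeau2017, §5.3.1 (5.14)–(5.16)] -/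
theorem dispS3_sub_mul_mainX3_eq (R : ℝ) (a₁ a₂ : ℤ) {𝒬 : Finset ℕ} (h𝒬 : ∀ q ∈ 𝒬, 0 < q)
    (ℳ 𝒩 : Finset ℕ) (γ w : ℕ → ℝ) (β : ℕ → ℂ) (A : ℂ) :
    dispS3 R a₁ a₂ 𝒬 ℳ 𝒩 γ w β - A * mainX3 R a₁ a₂ 𝒬 𝒩 γ β =
      ∑ q₁ ∈ 𝒬.filter (fun q : ℕ => IsCoprime (q : ℤ) (a₁ * a₂)),
        ∑ q₂ ∈ 𝒬.filter (fun q : ℕ => IsCoprime (q : ℤ) (a₁ * a₂)), (γ q₁ : ℂ) * (γ q₂ : ℂ) *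
          ((((Nat.totient q₁ : ℂ)) * (Nat.totient q₂ : ℂ))⁻¹ *
            ∑ χ₁ ∈ (univ.filter fun χ : DirichletCharacter ℂ q₁ => (χ.conductor : ℝ) ≤ R),
              ∑ χ₂ ∈ (univ.filter fun χ : DirichletCharacter ℂ q₂ => (χ.conductor : ℝ) ≤ R),
                ∑ n₁ ∈ 𝒩.filter (fun n : ℕ => IsCoprime (n : ℤ) a₂),
                  ∑ n₂ ∈ 𝒩.filter (fun n : ℕ => IsCoprime (n : ℤ) a₂),
                    β n₁ * starRingEnd ℂ (β n₂) *
                      (χ₁ ((n₁ : ZMod q₁) * ((a₁ : ZMod q₁))⁻¹ * (a₂ : ZMod q₁)) *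
                        (χ₂ ((n₂ : ZMod q₂) * ((a₁ : ZMod q₂))⁻¹ * (a₂ : ZMod q₂)))⁻¹) *
                      (∑ m ∈ ℳ, (w m : ℂ) * (χ₁ (m : ZMod q₁) * (χ₂ (m : ZMod q₂))⁻¹) -
                        A / (Nat.lcm q₁ q₂ : ℂ) *
                          ∑ j ∈ Finset.range (Nat.lcm q₁ q₂),
                            χ₁ (j : ZMod q₁) * (χ₂ (j : ZMod q₂))⁻¹)) := by
  rw [dispS3_eq_sum_chars, mul_mainX3_eq_sum_chars R a₁ a₂ h𝒬]
  simp only [← Finset.sum_sub_distrib, ← mul_sub]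

/-- **The reduction of `𝒮₃ = α̂(0)X₃ + [error]` to the Poisson-summation estimate**: if
`|∑_m w(m)χ₁χ̄₂(m) − (A/W)∑_{b mod W,(b,W)=1} χ₁χ̄₂(b)| ≤ E` for all `q₁, q₂` and all
`χⱼ ∈ 𝒳_{qⱼ}(R)`, then
`|𝒮₃ − A X₃| ≤ ∑_{q₁,q₂} |γ(q₁)γ(q₂)| (φ(q₁)φ(q₂))⁻¹ #𝒳_{q₁}(R) #𝒳_{q₂}(R) (∑_n |β_n|)² E`.
[cite: Drappeau2017, §5.3.1] -/
theorem norm_dispS3_sub_mul_mainX3_le (R : ℝ) (a₁ a₂ : ℤ) {𝒬 : Finset ℕ} (h𝒬 : ∀ q ∈ 𝒬, 0 < q)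
    (ℳ 𝒩 : Finset ℕ) (γ w : ℕ → ℝ) (β : ℕ → ℂ) (A : ℂ) {E : ℝ}
    (hE : ∀ q₁ ∈ 𝒬.filter (fun q : ℕ => IsCoprime (q : ℤ) (a₁ * a₂)),
      ∀ q₂ ∈ 𝒬.filter (fun q : ℕ => IsCoprime (q : ℤ) (a₁ * a₂)),
        ∀ χ₁ ∈ (univ.filter fun χ : DirichletCharacter ℂ q₁ => (χ.conductor : ℝ) ≤ R),
          ∀ χ₂ ∈ (univ.filter fun χ : DirichletCharacter ℂ q₂ => (χ.conductor : ℝ) ≤ R),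
            ‖∑ m ∈ ℳ, (w m : ℂ) * (χ₁ (m : ZMod q₁) * (χ₂ (m : ZMod q₂))⁻¹) -
                A / (Nat.lcm q₁ q₂ : ℂ) *
                  ∑ j ∈ Finset.range (Nat.lcm q₁ q₂), χ₁ (j : ZMod q₁) * (χ₂ (j : ZMod q₂))⁻¹‖ ≤ E) :
    ‖dispS3 R a₁ a₂ 𝒬 ℳ 𝒩 γ w β - A * mainX3 R a₁ a₂ 𝒬 𝒩 γ β‖ ≤
      ∑ q₁ ∈ 𝒬.filter (fun q : ℕ => IsCoprime (q : ℤ) (a₁ * a₂)),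
        ∑ q₂ ∈ 𝒬.filter (fun q : ℕ => IsCoprime (q : ℤ) (a₁ * a₂)), |γ q₁ * γ q₂| *
          ((((Nat.totient q₁ : ℝ)) * (Nat.totient q₂ : ℝ))⁻¹ *
            (((univ.filter fun χ : DirichletCharacter ℂ q₁ => (χ.conductor : ℝ) ≤ R).card : ℝ) *
              ((univ.filter fun χ : DirichletCharacter ℂ q₂ => (χ.conductor : ℝ) ≤ R).card : ℝ) *
              (∑ n ∈ 𝒩.filter (fun n : ℕ => IsCoprime (n : ℤ) a₂), ‖β n‖) ^ 2 * E)) := by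
  rw [dispS3_sub_mul_mainX3_eq R a₁ a₂ h𝒬]
  refine (norm_sum_le _ _).trans (Finset.sum_le_sum fun q₁ hq₁ => ?_)
  refine (norm_sum_le _ _).trans (Finset.sum_le_sum fun q₂ hq₂ => ?_)
  set 𝒩' := 𝒩.filter (fun n : ℕ => IsCoprime (n : ℤ) a₂) with h𝒩'
  set 𝒳₁ := (univ.filter fun χ : DirichletCharacter ℂ q₁ => (χ.conductor : ℝ) ≤ R) with h𝒳₁
  set 𝒳₂ := (univ.filter fun χ : DirichletCharacter ℂ q₂ => (χ.conductor : ℝ) ≤ R) with h𝒳₂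
  rw [norm_mul, norm_mul, Complex.norm_real, Complex.norm_real, Real.norm_eq_abs,
    Real.norm_eq_abs, ← abs_mul, norm_mul, norm_inv, norm_mul, Complex.norm_natCast,
    Complex.norm_natCast]
  refine mul_le_mul_of_nonneg_left (mul_le_mul_of_nonneg_left ?_ (by positivity)) (abs_nonneg _)
  have hinner : ∑ n₁ ∈ 𝒩', ∑ n₂ ∈ 𝒩', ‖β n₁‖ * ‖β n₂‖ * E = (∑ n ∈ 𝒩', ‖β n‖) ^ 2 * E := by
    rw [sq, Finset.sum_mul_sum, Finset.sum_mul]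
    refine Finset.sum_congr rfl fun n₁ _ => ?_
    rw [Finset.sum_mul]
  calc _ ≤ ∑ χ₁ ∈ 𝒳₁, ∑ χ₂ ∈ 𝒳₂, ∑ n₁ ∈ 𝒩', ∑ n₂ ∈ 𝒩', ‖β n₁‖ * ‖β n₂‖ * E := by
        refine (norm_sum_le _ _).trans (Finset.sum_le_sum fun χ₁ hχ₁ => ?_)
        refine (norm_sum_le _ _).trans (Finset.sum_le_sum fun χ₂ hχ₂ => ?_)
        refine (norm_sum_le _ _).trans (Finset.sum_le_sum fun n₁ _ => ?_)
        refine (norm_sum_le _ _).trans (Finset.sum_le_sum fun n₂ _ => ?_)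
        have hEχ := hE q₁ hq₁ q₂ hq₂ χ₁ hχ₁ χ₂ hχ₂
        have hu : ‖χ₁ ((n₁ : ZMod q₁) * ((a₁ : ZMod q₁))⁻¹ * (a₂ : ZMod q₁)) *
            (χ₂ ((n₂ : ZMod q₂) * ((a₁ : ZMod q₂))⁻¹ * (a₂ : ZMod q₂)))⁻¹‖ ≤ 1 := by
          rw [norm_mul]
          exact mul_le_one₀ (χ₁.norm_le_one _) (norm_nonneg _) (norm_inv_apply_le_one χ₂ _)
        rw [norm_mul, norm_mul, norm_mul, Complex.norm_conj]
        calc ‖β n₁‖ * ‖β n₂‖ * _ * _ ≤ ‖β n₁‖ * ‖β n₂‖ * 1 * E :=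
              mul_le_mul (mul_le_mul_of_nonneg_left hu (by positivity)) hEχ (norm_nonneg _)
                (by positivity)
          _ = ‖β n₁‖ * ‖β n₂‖ * E := by ring
    _ = _ := by
        simp only [hinner, Finset.sum_const, nsmul_eq_mul]
        ring

end Drappeau2017

end Literature.NumberTheory.Sieve

end
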